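import Summits.QuantumFields.BalabanUV.T4Continuum.Support.B13StepEnd
import Summits.QuantumFields.BalabanUV.T4Continuum.Support.B13StepOfRecord

/-!
# NE5 ∕ U3 — the termwise END face on the ASSEMBLED step model WITH W4 PRODUCED: the displayed insertion rate of
# `B13StepEnd.ne5_of_assembly` replaced, BY NAME, by the insertion-operator species' own two-run rate + one-run envelope ∕ bound
# + reach (`OutputRateInsertion.InsOpModel.insertionRate_of_insOp` with `ReadsIns` BY CONSTRUCTION); the same on the carriers OF RECORD
# (typer `t4/formal/NE5/DAG.md` node N06 «L08 PRODUCED modulo L08r ∧ L08e» on the model; sibling of `B13StepEnd`, agreed journal l.6641)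

Cell `pub-balaban`, unit `b2b-balaban-t4-ne5-formalise-leaf-10-g2` (NE5 formalisation swarm, LEAF PROVER 10, gen 2; the lineage's row
O6-n NUMERICS is `Support/OutputRateArithmetic` p207722).  This file is the SIBLING asked for by the author of `B13StepEnd` (leaf-09,
«→ leaf-10-g2: FILE THE SIBLING», `CLAIMS.log` l.6641) after the XREAD C-ne5leaf10-6 kernel-checked the composition; it imports
`B13StepEnd` and `B13StepOfRecord` BY NAME and edits nothing.  Summits-side new work under the LEAN PLACEMENT RULE (cell bookkeeping;
NOT a Literature module).  HONEST FRAMING: rung (B)+1 of the FINITE-VOLUME T⁴ continuum programme — NOT infinite volume, NOT a mass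
gap, NOT the Clay problem, and **NOT A PROOF OF NE5** (NOT PRINTED in [Balaban1987RG1]–[Balaban1989LargeFieldII], which print
ε-UNIFORM bounds, never η-RATES; cell GAPS G-t4-U3-1): every theorem below is an IMPLICATION whose wall binders are DISPLAYED
HYPOTHESES, asserted nowhere.  HONEST DEPENDENCY (cell line, verbatim): continuum YM on T⁴ ⇐ BetaPertH ∧ nine spine estimates
(0/9 proved); BetaPertH ⇐ (D1) ∧ (D4) ∧ CAP+tail; G-an2-4 gates asym, D1 and NE2/3/4.

WHAT THIS FILE DOES (compositions BY NAME; no estimate of its own).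
* §1 `insertionRate_of_insOp` — for the assembled model `𝔄.step BHist` of row O1-e (`B13Represents.Assembly`), the END faces' W4
  binder `StepModel.InsertionRate W κ E₀ δ′ θ` is PRODUCED from the insertion-operator SPECIES of row O1-c's datum
  (`B13HistInsertion.InsDatum.toInsOpModel`, margin `rI`): its reading `ReadsIns` holds BY CONSTRUCTION (`Assembly.readsIns`), so
  `OutputRateInsertion.InsOpModel.insertionRate_of_insOp` applies with the DISPLAYED inputs `InsOpRate δI θ` (the species' own
  two-run rate — NE2-TYPE, node U1a's object for the fine-lattice maps H, H₀, G̃, 𝐀₀ of [Balaban1988RG2Cluster] (1.5) p. 3, NOT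
  PRINTED), `InsOpEnvelope κ E₀ Gi` ∧ `InsBoundA κ E₀ Gi` (ONE-RUN analyticity + bound of the insertion along complex insertion-
  operator lines — the W2-ins class, GAPS G-ne5p1-1″, NOT PRINTED as stated) and the reach `δI·θ^{k₁} ≤ ρ₁ < 1`; output
  `δ′ = Gi·δI∕(1 − ρ₁) + 2Gi∕θ^{k₁}`.
* §2 `ne5_of_assembly_insOp` ∕ `ne5_of_assembly_opRate_insOp` — `B13StepEnd.ne5_of_assembly` ∕ `ne5_of_assembly_opRate` with `hins`
  manufactured by §1; every other binder BY NAME and unchanged; conclusion LITERALLY `T4OutputRate.NE5 (𝔄.outA …) (𝔄.outB …) W κ θ′ C₅`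
  with the END's constant at `δ′ := Gi·δI∕(1 − ρ₁) + 2Gi∕θ^{k₁}`.
* §3 `ne5_of_record_insOp` — the same on Bałaban's paired-torus carriers OF RECORD (`B13StepOfRecord.step S E₀ cB` over
  `B13Carriers.TwoRuns.carriers`), a one-line specialisation.
So the DISPLAYED census for NE5 on the model of record reads, after this file: the reading `TransportReads`; the two ONE-RUN slice
budgets (W3-KIND); the one-run levels `DecayBound outA∕outB` (L05∕L06 SHAPES, [Balaban1987RG1] (1.18) p. 263 — KIND); the raw-species
packaging + row NE2's weighted entrywise rate + margin floor (L07's inputs) or `OperatorRate` in margin units; the insertion-operator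
species' rate + envelope + bound + reach (this file's inputs, replacing W4); the termwise W2 data on the roomy class (wall O2); room;
numerics (L10∕L11).  Nothing of the manuscripts under audit is asserted; 0 sorry; no new axioms.
-/

noncomputable section

open Metric Set

namespace Summit.QuantumFields.BalabanUV.T4Continuum.B13StepEndInsOp

open Literature.MathematicalPhysics.QuantumFieldTheory.Balaban1983to89
open Literature.MathematicalPhysics.QuantumFieldTheory.Balaban1983to89.T4OutputRate (Carriers Functional DecayBound NE5)
open Literature.MathematicalPhysics.QuantumFieldTheory.Balaban1983to89.T4InputCauchyRateData (StepModel)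
open Literature.MathematicalPhysics.QuantumFieldTheory.Balaban1983to89.T4InputCauchyRateSpecies (ballClass)
open Literature.MathematicalPhysics.QuantumFieldTheory.Balaban1983to89.T4InputCauchyRateTermwise
  (TermBound TermBudget TermLineAnalytic)
open Summit.QuantumFields.BalabanUV.T4Continuum.B13Carriers (TwoRuns)
open Summit.QuantumFields.BalabanUV.T4Continuum.B13OpDatum (OpDatum)
open Summit.QuantumFields.BalabanUV.T4Continuum.B13OpDatumJunctions (RawBounded WeightedEntrywiseRate)
open Summit.QuantumFields.BalabanUV.T4Continuum.B13StepTermLabels (TermIdx InnerLabel)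
open Summit.QuantumFields.BalabanUV.T4Continuum.B13StepTermFamily (term)
open Summit.QuantumFields.BalabanUV.T4Continuum.B13InnerData (Bnd)
open Summit.QuantumFields.BalabanUV.T4Continuum.B13Base (selfCtr)
open Summit.QuantumFields.BalabanUV.T4Continuum.B13Represents (Assembly)
open Summit.QuantumFields.BalabanUV.T4Continuum.B13StepEnd (ne5_of_assembly ne5_of_assembly_opRate)
open Summit.QuantumFields.BalabanUV.T4Continuum.B13StepOfRecord (Slots assembly step outA outB)
open Summit.QuantumFields.BalabanUV.T4Continuum.OutputRateInsertion (InsOpModel)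

/-! ## §1 W4 PRODUCED for the assembled model from the insertion-operator species of row O1-c's datum -/

section Assembled

variable {C : Carriers} {E IOp Hist ι P J : Type*} [NormedAddCommGroup Hist] [NormedSpace ℂ Hist] [CompleteSpace Hist]
  [NormedAddCommGroup IOp] [NormedSpace ℂ IOp] (𝔄 : Assembly C E IOp Hist ι P J)

/-- [folklore] **W4 PRODUCED FOR THE ASSEMBLED MODEL.**  For `𝔄.step BHist` (row O1-e) and the insertion-operator species
`𝔄.D.toInsOpModel (𝔄.step BHist) rI hrI` of row O1-c's datum (whose reading `ReadsIns` holds BY CONSTRUCTION, `Assembly.readsIns`):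
the DISPLAYED one-run envelope `InsOpEnvelope κ E₀ Gi` and bound `InsBoundA κ E₀ Gi`, the DISPLAYED two-run rate `InsOpRate δI θ` of
the insertion operators (NE2-TYPE, NOT PRINTED), `0 < θ ≤ 1` and the reach `δI·θ^{k₁} ≤ ρ₁ < 1` give the END faces' binder
`StepModel.InsertionRate W κ E₀ (Gi·δI∕(1 − ρ₁) + 2Gi∕θ^{k₁}) θ` — `OutputRateInsertion.InsOpModel.insertionRate_of_insOp` BY NAME. -/
theorem insertionRate_of_insOp (BHist : ℕ → ℝ) {W : Set (ℕ → ℝ)} {κ E₀ Gi δI θ ρ₁ : ℝ} {k₁ : ℕ} (rI : ℕ → ℝ)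
    (hrI : ∀ k, 0 < rI k) (hienv : (𝔄.D.toInsOpModel (𝔄.step BHist) rI hrI).InsOpEnvelope W κ E₀ Gi)
    (hibdA : (𝔄.D.toInsOpModel (𝔄.step BHist) rI hrI).InsBoundA W κ E₀ Gi)
    (hirate : (𝔄.D.toInsOpModel (𝔄.step BHist) rI hrI).InsOpRate W δI θ) (hδI : 0 ≤ δI) (hθ0 : 0 < θ) (hθ1 : θ ≤ 1)
    (hρ₁ : ρ₁ < 1) (hreach : δI * θ ^ k₁ ≤ ρ₁) :
    (𝔄.step BHist).InsertionRate W κ E₀ (Gi * δI / (1 - ρ₁) + 2 * Gi / θ ^ k₁) θ :=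
  InsOpModel.insertionRate_of_insOp _ (𝔄.readsIns BHist rI hrI W) hienv hibdA hirate hδI hθ0 hθ1 hρ₁ hreach

/-- [folklore] The produced `δ′` is nonnegative when `Gi`, `δI` are and `ρ₁ < 1`, `0 < θ`. -/
theorem deltaIns_nonneg {Gi δI θ ρ₁ : ℝ} {k₁ : ℕ} (hGi : 0 ≤ Gi) (hδI : 0 ≤ δI) (hθ0 : 0 < θ) (hρ₁ : ρ₁ < 1) :
    0 ≤ Gi * δI / (1 - ρ₁) + 2 * Gi / θ ^ k₁ :=
  add_nonneg (div_nonneg (mul_nonneg hGi hδI) (by linarith)) (div_nonneg (by positivity) (pow_pos hθ0 k₁).le)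

/-! ## §2 The termwise END face on the assembled model with W4 produced -/

/-- [folklore] **THE TERMWISE END FACE ON THE ASSEMBLED MODEL, W4 PRODUCED** — `B13StepEnd.ne5_of_assembly` (W1 in row NE2's ENTRY
currency) with its displayed `hins : InsertionRate W κ E₀ δ′ θ` replaced by §1's inputs: the insertion-operator species' one-run
envelope `InsOpEnvelope κ E₀ Gi` ∧ bound `InsBoundA κ E₀ Gi` (W2-ins class, NOT PRINTED as stated), its two-run rate `InsOpRate δI θ`
(NE2-TYPE, NOT PRINTED), `0 ≤ Gi`, and the reach `δI·θ^{k₁} ≤ ρ₁ < 1`; `δ′ := Gi·δI∕(1 − ρ₁) + 2Gi∕θ^{k₁}` in the near hypothesis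
and in the constant; `0 < θ`.  Every other binder of `ne5_of_assembly` BY NAME and unchanged (reading `TransportReads`; the two
one-run slice budgets; `DecayBound outA∕outB`; `RawBounded` ×2 + `WeightedEntrywiseRate c₁ θ^k` + floor `r₀`; the termwise W2 data
on `ballClass (selfCtr raw histRef) ROp RHist`; room; numerics).  Conclusion LITERALLY `NE5 outA outB W κ θ′ C₅`.  NOT a proof of
NE5: an implication from displayed binders. -/
theorem ne5_of_assembly_insOp {W : Set (ℕ → ℝ)} {ROp RHist : ℕ → ℝ} {a : ℕ → ι → ℝ}
    {κ G EA₀ E₀ E₁ cA cB c₁ r₀ Gi δI ρ₁ θ θ' ρ₀ B : ℝ} {k₀ k₁ : ℕ} (rI : ℕ → ℝ) (hrI : ∀ k, 0 < rI k)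
    (hT : 𝔄.TransportReads W)
    (hbB : 𝔄.SliceBudgetB W κ cB) (hbA : 𝔄.D.SliceBudget (𝔄.step (𝔄.bHist E₀ cB)) W κ cA)
    (hdA : DecayBound (𝔄.outA (𝔄.bHist E₀ cB)) W EA₀ κ) (hdB : DecayBound (𝔄.outB (𝔄.bHist E₀ cB)) W E₀ κ)
    (hRA : RawBounded 𝔄.F 𝔄.rawAt W) (hRB : RawBounded 𝔄.F 𝔄.rawB W)
    (hwer : WeightedEntrywiseRate 𝔄.F 𝔄.rawAt 𝔄.rawB W c₁ fun k => θ ^ k) (hfl : ∀ k, r₀ ≤ 𝔄.rOp k)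
    (hienv : (𝔄.D.toInsOpModel (𝔄.step (𝔄.bHist E₀ cB)) rI hrI).InsOpEnvelope W κ E₀ Gi)
    (hibdA : (𝔄.D.toInsOpModel (𝔄.step (𝔄.bHist E₀ cB)) rI hrI).InsBoundA W κ E₀ Gi)
    (hirate : (𝔄.D.toInsOpModel (𝔄.step (𝔄.bHist E₀ cB)) rI hrI).InsOpRate W δI θ) (hδI : 0 ≤ δI) (hGi : 0 ≤ Gi)
    (hρ₁ : ρ₁ < 1) (hreach : δI * θ ^ k₁ ≤ ρ₁)
    (hbd : TermBound (ballClass (selfCtr 𝔄.raw 𝔄.histRef) ROp RHist) (term 𝔄.𝒯 𝔄.inc 𝔄.act) W κ a)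
    (hbud : TermBudget a G) (hline : TermLineAnalytic (ballClass (selfCtr 𝔄.raw 𝔄.histRef) ROp RHist) (term 𝔄.𝒯 𝔄.inc 𝔄.act) W)
    (hOp : ∀ k, 𝔄.rOp k ≤ ROp k) (hHist : ∀ k, 𝔄.bHist E₀ cB k + 𝔄.rHist k ≤ RHist k)
    (hE₀ : 0 ≤ E₀) (hE₁ : 0 < E₁) (hG : 0 ≤ G) (hcA : 0 ≤ cA) (hcB : 0 ≤ cB) (hc₁ : 0 ≤ c₁) (hr₀ : 0 < r₀)
    (hθ0 : 0 < θ) (hθθ' : θ ≤ θ') (hθ'1 : θ' ≤ 1) (hω : 0 < 𝔄.D.ω) (hω1 : 𝔄.D.ω < 1) (hρ₀ : ρ₀ < 1)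
    (hnear : (c₁ / r₀ + (Gi * δI / (1 - ρ₁) + 2 * Gi / θ ^ k₁)) * θ ^ k₀ + cA * (EA₀ + E₀) / (1 - 𝔄.D.ω) ≤ ρ₀) (hB : 0 ≤ B)
    (hfirst : ∀ k < k₀, EA₀ + E₀ ≤ B * θ ^ k) (hsmall : 𝔄.D.ω + G / (1 - ρ₀) * cA < θ') :
    NE5 (𝔄.outA (𝔄.bHist E₀ cB)) (𝔄.outB (𝔄.bHist E₀ cB)) W κ θ'
      ((G / (1 - ρ₀) * (c₁ / r₀) + G / (1 - ρ₀) * (Gi * δI / (1 - ρ₁) + 2 * Gi / θ ^ k₁) + B) * (θ' - 𝔄.D.ω) /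
        (θ' - (𝔄.D.ω + G / (1 - ρ₀) * cA))) :=
  ne5_of_assembly 𝔄 hT hbB hbA hdA hdB hRA hRB hwer hfl
    (insertionRate_of_insOp 𝔄 _ rI hrI hienv hibdA hirate hδI hθ0 (hθθ'.trans hθ'1) hρ₁ hreach) hbd hbud hline hOp hHist hE₀ hE₁
    hG hcA hcB hc₁ hr₀ (deltaIns_nonneg hGi hδI hθ0 hρ₁) hθ0.le hθθ' hθ'1 hω hω1 hρ₀ hnear hB hfirst hsmall

/-- [folklore] **THE SAME WITH W1 IN MARGIN UNITS** (`OperatorRate δ θ` displayed — the tower-reading fork of row O4-r), W4 produced. -/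
theorem ne5_of_assembly_opRate_insOp {W : Set (ℕ → ℝ)} {ROp RHist : ℕ → ℝ} {a : ℕ → ι → ℝ}
    {κ G EA₀ E₀ E₁ cA cB δ Gi δI ρ₁ θ θ' ρ₀ B : ℝ} {k₀ k₁ : ℕ} (rI : ℕ → ℝ) (hrI : ∀ k, 0 < rI k)
    (hT : 𝔄.TransportReads W)
    (hbB : 𝔄.SliceBudgetB W κ cB) (hbA : 𝔄.D.SliceBudget (𝔄.step (𝔄.bHist E₀ cB)) W κ cA)
    (hdA : DecayBound (𝔄.outA (𝔄.bHist E₀ cB)) W EA₀ κ) (hdB : DecayBound (𝔄.outB (𝔄.bHist E₀ cB)) W E₀ κ)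
    (hop : (𝔄.step (𝔄.bHist E₀ cB)).OperatorRate W δ θ)
    (hienv : (𝔄.D.toInsOpModel (𝔄.step (𝔄.bHist E₀ cB)) rI hrI).InsOpEnvelope W κ E₀ Gi)
    (hibdA : (𝔄.D.toInsOpModel (𝔄.step (𝔄.bHist E₀ cB)) rI hrI).InsBoundA W κ E₀ Gi)
    (hirate : (𝔄.D.toInsOpModel (𝔄.step (𝔄.bHist E₀ cB)) rI hrI).InsOpRate W δI θ) (hδI : 0 ≤ δI) (hGi : 0 ≤ Gi)
    (hρ₁ : ρ₁ < 1) (hreach : δI * θ ^ k₁ ≤ ρ₁)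
    (hbd : TermBound (ballClass (selfCtr 𝔄.raw 𝔄.histRef) ROp RHist) (term 𝔄.𝒯 𝔄.inc 𝔄.act) W κ a)
    (hbud : TermBudget a G) (hline : TermLineAnalytic (ballClass (selfCtr 𝔄.raw 𝔄.histRef) ROp RHist) (term 𝔄.𝒯 𝔄.inc 𝔄.act) W)
    (hOp : ∀ k, 𝔄.rOp k ≤ ROp k) (hHist : ∀ k, 𝔄.bHist E₀ cB k + 𝔄.rHist k ≤ RHist k)
    (hE₀ : 0 ≤ E₀) (hE₁ : 0 < E₁) (hG : 0 ≤ G) (hcA : 0 ≤ cA) (hcB : 0 ≤ cB) (hδ : 0 ≤ δ)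
    (hθ0 : 0 < θ) (hθθ' : θ ≤ θ') (hθ'1 : θ' ≤ 1) (hω : 0 < 𝔄.D.ω) (hω1 : 𝔄.D.ω < 1) (hρ₀ : ρ₀ < 1)
    (hnear : (δ + (Gi * δI / (1 - ρ₁) + 2 * Gi / θ ^ k₁)) * θ ^ k₀ + cA * (EA₀ + E₀) / (1 - 𝔄.D.ω) ≤ ρ₀) (hB : 0 ≤ B)
    (hfirst : ∀ k < k₀, EA₀ + E₀ ≤ B * θ ^ k) (hsmall : 𝔄.D.ω + G / (1 - ρ₀) * cA < θ') :
    NE5 (𝔄.outA (𝔄.bHist E₀ cB)) (𝔄.outB (𝔄.bHist E₀ cB)) W κ θ'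
      ((G / (1 - ρ₀) * δ + G / (1 - ρ₀) * (Gi * δI / (1 - ρ₁) + 2 * Gi / θ ^ k₁) + B) * (θ' - 𝔄.D.ω) /
        (θ' - (𝔄.D.ω + G / (1 - ρ₀) * cA))) :=
  ne5_of_assembly_opRate 𝔄 hT hbB hbA hdA hdB hop
    (insertionRate_of_insOp 𝔄 _ rI hrI hienv hibdA hirate hδI hθ0 (hθθ'.trans hθ'1) hρ₁ hreach) hbd hbud hline hOp hHist hE₀ hE₁
    hG hcA hcB hδ (deltaIns_nonneg hGi hδI hθ0 hρ₁) hθ0.le hθθ' hθ'1 hω hω1 hρ₀ hnear hB hfirst hsmall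

end Assembled

/-! ## §3 The same on Bałaban's paired-torus carriers OF RECORD -/

section OfRecord

variable {G : Type} [GaugeGroup G] {R : TwoRuns G} {E IOp Hist : Type*} [NormedAddCommGroup Hist] [NormedSpace ℂ Hist]
  [CompleteSpace Hist] [NormedAddCommGroup IOp] [NormedSpace ℂ IOp] (S : Slots R E IOp Hist) (E₀ cB : ℝ)

/-- [folklore] **THE TERMWISE END FACE ON THE CARRIERS OF RECORD, W4 PRODUCED**: `ne5_of_assembly_insOp` for the assembly of record
`B13StepOfRecord.assembly S` (indexing `labelsIndexing …`, hard core `touchInc …` OF RECORD), i.e. for the model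
`B13StepOfRecord.step S E₀ cB : StepModel R.carriers (OpDatum E) Hist` on `B13Carriers.TwoRuns.carriers R` — conclusion LITERALLY
`T4OutputRate.NE5 (outA S E₀ cB) (outB S E₀ cB) W κ θ′ C₅`, the shape node U3's consumers read; every wall displayed; the analytic
slots `S` are PARAMETERS (nothing of [Balaban1988RG2Cluster]'s kernels ∕ potentials ∕ (2.14)-terms is identified here). -/
theorem ne5_of_record_insOp {W : Set (ℕ → ℝ)} {ROp RHist : ℕ → ℝ} {a : ℕ → TermIdx R.carriers.Dom (Bnd R) → ℝ}
    {κ G EA₀ E₁ cA c₁ r₀ Gi δI ρ₁ θ θ' ρ₀ B : ℝ} {k₀ k₁ : ℕ} (rI : ℕ → ℝ) (hrI : ∀ k, 0 < rI k)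
    (hT : (assembly S).TransportReads W)
    (hbB : (assembly S).SliceBudgetB W κ cB) (hbA : S.D.SliceBudget (step S E₀ cB) W κ cA)
    (hdA : DecayBound (outA S E₀ cB) W EA₀ κ) (hdB : DecayBound (outB S E₀ cB) W E₀ κ)
    (hRA : RawBounded S.F (assembly S).rawAt W) (hRB : RawBounded S.F S.rawB W)
    (hwer : WeightedEntrywiseRate S.F (assembly S).rawAt S.rawB W c₁ fun k => θ ^ k) (hfl : ∀ k, r₀ ≤ S.rOp k)
    (hienv : (S.D.toInsOpModel (step S E₀ cB) rI hrI).InsOpEnvelope W κ E₀ Gi)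
    (hibdA : (S.D.toInsOpModel (step S E₀ cB) rI hrI).InsBoundA W κ E₀ Gi)
    (hirate : (S.D.toInsOpModel (step S E₀ cB) rI hrI).InsOpRate W δI θ) (hδI : 0 ≤ δI) (hGi : 0 ≤ Gi) (hρ₁ : ρ₁ < 1)
    (hreach : δI * θ ^ k₁ ≤ ρ₁)
    (hbd : TermBound (ballClass (selfCtr (assembly S).raw (assembly S).histRef) ROp RHist)
      (term (assembly S).𝒯 (assembly S).inc S.act) W κ a)
    (hbud : TermBudget a G)
    (hline : TermLineAnalytic (ballClass (selfCtr (assembly S).raw (assembly S).histRef) ROp RHist)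
      (term (assembly S).𝒯 (assembly S).inc S.act) W)
    (hOp : ∀ k, S.rOp k ≤ ROp k) (hHist : ∀ k, (assembly S).bHist E₀ cB k + S.rHist k ≤ RHist k)
    (hE₀ : 0 ≤ E₀) (hE₁ : 0 < E₁) (hG : 0 ≤ G) (hcA : 0 ≤ cA) (hcB : 0 ≤ cB) (hc₁ : 0 ≤ c₁) (hr₀ : 0 < r₀)
    (hθ0 : 0 < θ) (hθθ' : θ ≤ θ') (hθ'1 : θ' ≤ 1) (hω : 0 < S.D.ω) (hω1 : S.D.ω < 1) (hρ₀ : ρ₀ < 1)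
    (hnear : (c₁ / r₀ + (Gi * δI / (1 - ρ₁) + 2 * Gi / θ ^ k₁)) * θ ^ k₀ + cA * (EA₀ + E₀) / (1 - S.D.ω) ≤ ρ₀) (hB : 0 ≤ B)
    (hfirst : ∀ k < k₀, EA₀ + E₀ ≤ B * θ ^ k) (hsmall : S.D.ω + G / (1 - ρ₀) * cA < θ') :
    NE5 (outA S E₀ cB) (outB S E₀ cB) W κ θ'
      ((G / (1 - ρ₀) * (c₁ / r₀) + G / (1 - ρ₀) * (Gi * δI / (1 - ρ₁) + 2 * Gi / θ ^ k₁) + B) * (θ' - S.D.ω) /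
        (θ' - (S.D.ω + G / (1 - ρ₀) * cA))) :=
  ne5_of_assembly_insOp (assembly S) rI hrI hT hbB hbA hdA hdB hRA hRB hwer hfl hienv hibdA hirate hδI hGi hρ₁ hreach hbd hbud
    hline hOp hHist hE₀ hE₁ hG hcA hcB hc₁ hr₀ hθ0 hθθ' hθ'1 hω hω1 hρ₀ hnear hB hfirst hsmall

end OfRecord

end Summit.QuantumFields.BalabanUV.T4Continuum.B13StepEndInsOp

end
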